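import Summits.AnomalousDissipation.AnomalousDissipation.Theorems.EnsembleRigidityGPTameDefectFloorParityForm3
import Summits.AnomalousDissipation.AnomalousDissipation.Theorems.TameRoughRigidityGPEulerCoerciveLinearRung
import Summits.AnomalousDissipation.AnomalousDissipation.Theorems.EnsembleRigidityGPStatisticalRigidityPartial
import HarnessLib

/-!
# The enstrophy floor `150/7` of stationary Euler statistics of `f_GP` — crux
  `TameRoughRigidity.GPEulerCoercive` (stmt-AnomalousDissipation-18400), line `floor_duality_galerkin`,
  tools stub `stub_gpEulerFloor150Tools`

The crux N = `GPEulerCoercive`: no Borel probability measure on `H = L²_σ(T³)` is a stationary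
statistical solution of the EULER equations forced by the Galloway–Proctor force
`f_GP = sin(2πx₂)e₀ + sin(2πx₀)e₁ + sin(2πx₁)e₂` (`gpForce`). The line reduces N to an unbounded
ladder of enstrophy floors; this file lands the SECOND RUNG:

  every stationary Euler statistics `μ` of `f_GP` has mean enstrophy `∫ ‖∇v‖² dμ ≥ 150/7 ≈ 21.43`,

more than doubling the landed floor `3π ≈ 9.42` (`stub_gpEulerFloorTools`, the crude pointwise
strain bound). It is the composition of two landed results:

* the pointwise linear certificate of the sibling crux `GPTameDefectFloor` (line `Sketch`, file
  `…GPTameDefectFloorParityForm3.lean`, `stub_gpParityForm3`): `∫ (v ⊗ v) : ∇f_GP ≥ −(7/100)‖∇v‖²`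
  at every finite-enstrophy `v ∈ H` (one-shift Parseval with ratio slot weights from an integer
  potential table; the sharp constant is `≈ 0.0583`), i.e. the test field `w = (100/7) f_GP`
  satisfies `∫ (v ⊗ v) : ∇w ≥ −‖∇v‖²`;
* the rung-maker of this line (`…GPEulerCoerciveLinearRung.lean`,
  `ensembleEnstrophy_ge_pairing_of_pointwise`): such a pointwise linear certificate makes
  `(f_GP, w) = (100/7)·(3/2) = 150/7` an enstrophy floor of every stationary Euler statistics of
  `f_GP` (the Liouville identity passed to the fixed linear test by `stub_linearTestLimit` at zero
  defect).

## Contents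

* `inertialPairing_const_smul_gpForce`, `integral_inner_gpForce_const_smul` — homogeneity in the test.
* `ensembleEnstrophy_ge_floor150_of_eulerSSS` — the floor `150/7`.
* `gpEulerCoercive_enstrophy_lt_floor150` — N on the class `ensembleEnstrophy μ < 150/7`, verbatim shape.
* `stub_gpEulerFloor150Tools` — registered tools stub (conjunction).

## References

* C. Foias, O. Manley, R. Rosa, R. Temam, *Navier–Stokes Equations and Turbulence* (CUP 2001),
  Ch. IV §1.2 (1.30), §1.1 (1.11).
* P. Constantin, C. Foias, *Navier–Stokes Equations* (Chicago 1988), Ch. 4 (4.33) (the trilinear form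
  on the torus in Fourier variables).
-/

-- `Summit.<Summit>.<Problem>` is the tree's mandated summit-side namespace (CONVENTIONS §2); single-conjunct summit, duplicate deliberate.
set_option linter.dupNamespace false

noncomputable section

namespace Summit.AnomalousDissipation.AnomalousDissipation.Theorems.TameRoughRigidity.GPEulerCoercive

open MeasureTheory Filter Topology UnitAddTorus
open scoped InnerProductSpace RealInnerProductSpace ENNReal NNReal
open Literature.Analysis.FunctionSpaces Literature.Analysis.FluidPDE
open Summit.AnomalousDissipation.AnomalousDissipation.Theorems.EnsembleRigidity
open Summit.AnomalousDissipation.AnomalousDissipation.Theorems.EnsembleRigidity.GPStatisticalRigidity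
open Summit.AnomalousDissipation.AnomalousDissipation.Theorems.EnsembleRigidity.GPTameDefectFloor

/-- Local notation: real vector fields on `T³`. -/
local notation "Vec3" => (UnitAddTorus (Fin 3)) → (EuclideanSpace ℝ (Fin 3))
/-- Local notation: `L²(T³; ℝ³)`. -/
local notation "L2" => (Lp (EuclideanSpace ℝ (Fin 3)) 2 (volume : Measure (UnitAddTorus (Fin 3))))
/-- Local notation: the energy space `H`. -/
local notation "H3" => (Torus.energySpace (Fin 3))

/-! ## Homogeneity in the test field -/

/-- `∫ (u ⊗ u) : ∇(c f_GP) = c ∫ (u ⊗ u) : ∇f_GP` (`∇(c w) = c ∇w` for the smooth `f_GP`). [folklore] -/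
theorem inertialPairing_const_smul_gpForce (u : L2) (c : ℝ) :
    Torus.inertialPairing u (c • gpForce) = c * Torus.inertialPairing u gpForce := by
  unfold Torus.inertialPairing
  have hfd : ∀ x a, Torus.fderiv (c • gpForce) x a = c • Torus.fderiv gpForce x a := by
    intro x a
    rw [Torus.fderiv_const_smul (gpForce_isSmooth.isContDiff (by simp)) c x]
    rfl
  simp_rw [hfd, real_inner_smul_left, integral_const_mul]

/-- `(f_GP, c f_GP) = (3/2) c`. [folklore] -/
theorem integral_inner_gpForce_const_smul (c : ℝ) :
    ∫ x, ⟪gpForce x, (c • gpForce) x⟫_ℝ = c * (3 / 2) := by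
  simp_rw [Pi.smul_apply, real_inner_smul_right, integral_const_mul, gpForce_integral_inner_self]

/-! ## The floor -/

/-- **Enstrophy floor `150/7`.** Every stationary Euler statistics `μ` of `f_GP` has mean enstrophy
`∫ ‖∇v‖² dμ ≥ 150/7`: the sibling crux's pointwise certificate
`∫ (v ⊗ v) : ∇f_GP ≥ −(7/100)‖∇v‖²` (`stub_gpParityForm3`) says the test `w = (100/7) f_GP` obeys
`∫ (v ⊗ v) : ∇w ≥ −‖∇v‖²` on `H`, and the line's rung-maker
(`ensembleEnstrophy_ge_pairing_of_pointwise`) turns that into the floor `(f_GP, w) = 150/7`. [folklore] -/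
theorem ensembleEnstrophy_ge_floor150_of_eulerSSS {μ : Measure H3}
    (hμ : Torus.IsStationaryStatisticalSolution 0 gpForce μ) :
    ENNReal.ofReal (150 / 7) ≤ Torus.ensembleEnstrophy μ := by
  obtain ⟨hsm, hdf, hzm⟩ := gpForce_admissible
  set w : Vec3 := (100 / 7 : ℝ) • gpForce with hw_def
  have hws : Torus.IsSmooth w := Torus.IsSmooth.smul _ hsm
  have hwd : Torus.IsDivFree w := fun x => by
    rw [hw_def, Torus.divergence_const_smul (hsm.isContDiff (by simp)), hdf x, mul_zero]
  have hwz : Torus.HasZeroMean w := by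
    unfold Torus.HasZeroMean
    rw [hw_def]
    simp [integral_smul, show ∫ x, gpForce x = 0 from hzm]
  have hcert : ∀ v : H3, Torus.eGradNormSq ((v : L2) : Vec3) ≠ ⊤ →
      -(Torus.eGradNormSq ((v : L2) : Vec3)).toReal ≤ Torus.inertialPairing (v : L2) w := by
    intro v hv
    have h := stub_gpParityForm3 v hv
    rw [hw_def, inertialPairing_const_smul_gpForce]
    linarith
  have h := ensembleEnstrophy_ge_pairing_of_pointwise gpForce w (hsm.memLp 2) hws hwd hwz hcert μ hμ
  rw [hw_def, integral_inner_gpForce_const_smul] at h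
  have h150 : (100 / 7 : ℝ) * (3 / 2) = 150 / 7 := by norm_num
  rwa [h150] at h

/-- Real form of the floor: `(∫ ‖∇v‖² dμ).toReal ≥ 150/7` (the mean enstrophy of a stationary
statistics is finite). [folklore] -/
theorem ensembleEnstrophy_toReal_ge_floor150_of_eulerSSS {μ : Measure H3}
    (hμ : Torus.IsStationaryStatisticalSolution 0 gpForce μ) :
    150 / 7 ≤ (Torus.ensembleEnstrophy μ).toReal :=
  (ENNReal.ofReal_le_iff_le_toReal hμ.enstrophy_finite.ne).1
    (ensembleEnstrophy_ge_floor150_of_eulerSSS hμ)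

/-! ## N on the class of small enstrophy, verbatim shape -/

/-- **`GPEulerCoercive` below the enstrophy level `150/7`**: in the verbatim shape of the route
declaration (inline force), no probability measure of mean enstrophy `< 150/7` is a stationary Euler
statistics of `f_GP`. [folklore] -/
theorem gpEulerCoercive_enstrophy_lt_floor150 (f : Vec3)
    (hf : f = (fun x : UnitAddTorus (Fin 3) =>
      (Literature.Analysis.FluidPDE.Torus.stokesMode (Pi.single (2 : Fin 3) (1 : ℤ))
          (EuclideanSpace.single (0 : Fin 3) (1 : ℝ)) false x +
        Literature.Analysis.FluidPDE.Torus.stokesMode (Pi.single (0 : Fin 3) (1 : ℤ))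
          (EuclideanSpace.single (1 : Fin 3) (1 : ℝ)) false x +
        Literature.Analysis.FluidPDE.Torus.stokesMode (Pi.single (1 : Fin 3) (1 : ℤ))
          (EuclideanSpace.single (2 : Fin 3) (1 : ℝ)) false x : EuclideanSpace ℝ (Fin 3))))
    (μ : Measure H3) (hG : Torus.ensembleEnstrophy μ < ENNReal.ofReal (150 / 7)) :
    ¬ Torus.IsStationaryStatisticalSolution 0 f μ := by
  have hf' : f = gpForce := hf.trans gpForce_eq.symm
  subst hf'
  intro hμ
  exact absurd (ensembleEnstrophy_ge_floor150_of_eulerSSS hμ) (not_le.2 hG)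

/-! ## The registered tools stub -/

/-- **Tools stub `stub_gpEulerFloor150Tools`** (registered on stmt-AnomalousDissipation-18400, line
`floor_duality_galerkin`): the second rung of the enstrophy-floor ladder — every stationary Euler
statistics of `f_GP` has mean enstrophy `≥ 150/7`, and hence the crux N holds on the class
`ensembleEnstrophy μ < 150/7`. [folklore] -/
theorem stub_gpEulerFloor150Tools :
    (∀ μ : Measure H3, Torus.IsStationaryStatisticalSolution 0 gpForce μ → ENNReal.ofReal (150 / 7) ≤ Torus.ensembleEnstrophy μ) ∧ (∀ f : Vec3, f = gpForce → ∀ μ : Measure H3, Torus.ensembleEnstrophy μ < ENNReal.ofReal (150 / 7) → ¬ Torus.IsStationaryStatisticalSolution 0 f μ) :=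
  ⟨fun _ hμ => ensembleEnstrophy_ge_floor150_of_eulerSSS hμ,
    fun f hf μ hG => gpEulerCoercive_enstrophy_lt_floor150 f (hf.trans gpForce_eq) μ hG⟩

end Summit.AnomalousDissipation.AnomalousDissipation.Theorems.TameRoughRigidity.GPEulerCoercive

end
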